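import Summits.PneNP.PneNP.Theorems.ExpanderLinearGeneratorsResolutionNFreeColumnCount
import Summits.PneNP.PneNP.Theorems.ExpanderLinearGeneratorsResolutionNFreeColumnAlter
import HarnessLib

/-!
# The n-free resolution-size rung for expanding linear systems, XI: the altered master inequality

Support file for crux `stmt-PneNP-11442`
(`Summit.PneNP.PneNP.Theses.ExpanderLinearGenerators.ExpansionForcesDepthFregeSize`, the
expansion-scale law, uniform in the numbers `n` of variables and `m` of rows). Files IX (counting)
and X (alteration) combine into the MASTER INEQUALITY of the ALTERED restriction method
(`one_le_length_mul_alter`): if the row supports of `E : Fin m → LinEqMod 2 n` have size `≤ ℓ`,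
form an `(r, c)`-boundary expander (`r ≥ 2`) and every variable lies in at most `Δ` rows (COLUMN
WEIGHT `≤ Δ`), then for every resolution refutation `π` of `sumEncoding 1 E`, every `L < c`,
`W < (c - L) r / 2`, `K`, and `1 ≤ s ≤ r`, with `Q = ⌊W/2⌋ + 1`,

  `1 ≤ |π| · ( 2^{ℓ(s-1)} ((2K+1)/(2K+2))^Q + (Q Δ)^s 2^{ℓ s} / (K+1)^{(L+1)s + ⌈c s⌉ - ℓ s} )`.

Neither `n` nor `m` occurs, and — unlike the master inequality of file III — there is NO overload
term charged to the rows: every sample `(u, y)` is used, after un-assigning the variables of its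
overloaded rows (file X). A line of `π` left unsatisfied with `> W` unassigned literals by the
altered restriction has `Q` variables `T₀` on which either (few damaged) the sample avoids the
satisfying value on every undamaged assigned point — file IX's fibrewise count, first term — or
(many damaged) `s` distinct overloaded rows meet `T₀` (file X's extraction), a family chosen among
`≤ (QΔ)^s` and overloaded with probability `≤ 2^{ℓ s}/(K+1)^{(L+1+c-ℓ)s}` by file X's double
counting and expansion (`card_all_overloaded_le`) — second term. File XII turns this into the
n-free EXPONENTIAL law `|π| ≥ 2^{r^ε/(128 ℓ) - 1}` at column weight `Δ ≤ r^{(1-ε)ℓ/2 - 1}/2^ℓ`.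

References: P. Beame, T. Pitassi, FOCS 1996; E. Ben-Sasson, A. Wigderson, J. ACM 48 (2001), §3,
§6, Thm. 6.5; N. Alon, J. Spencer, *The probabilistic method*, §3; J. Krajíček, *Proof complexity*
(CUP 2019), §13.4.
-/

namespace Summit.PneNP.PneNP.Theorems.ResNFree

set_option linter.dupNamespace false -- `Summit.PneNP.PneNP.…`: summit = sub-problem (D-0017)

open Finset Literature.Computability.Complexity Literature.Computability.MetaComplexity
open Summit.PneNP.PneNP.Theorems.ResKRestriction

variable {m n : ℕ}

/-- **All-overloaded families are rare, however they overlap.** If the row supports of `E` have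
size `≤ ℓ` and form an `(r, c)`-boundary expander, then for a family `F` of at most `r` rows the
samples overloading EVERY row of `F` (at least `L + 1` assigned variables each) form at most a
`2^{ℓ|F|} / (K+1)^{(L+1)|F| + ⌈c|F|⌉ - ℓ|F|}` fraction of the space: by file X's double counting and
expansion they assign at least that many BOUNDARY points of `F`, which are distinct variables.
[Ben-Sasson–Wigderson 2001, §6; Alon–Spencer §3; Beame–Pitassi 1996] [folklore] -/
theorem card_all_overloaded_le (E : Fin m → LinEqMod 2 n) {r c : ℝ}
    (hexp : IsBoundaryExpander (rowVars E) r c) {ℓ L K : ℕ} (hsparse : ∀ i, (E i).supp.card ≤ ℓ)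
    (F : Finset (Fin m)) (hFr : (F.card : ℝ) ≤ r)
    (s : Finset ((Fin n → Fin (K + 1)) × (Fin n → Bool)))
    (hs : ∀ ω ∈ s, ∀ i ∈ F, L + 1 ≤ ((rowVars E i) ∩
      ((univ.filter fun j : Fin n => ω.1 j = 0).map Fin.valEmbedding)).card) :
    (s.card : ℝ) * ((K : ℝ) + 1) ^ ((L + 1) * F.card + ⌈c * F.card⌉₊ - ℓ * F.card)
      ≤ (2 : ℝ) ^ (ℓ * F.card) * ((K + 1) ^ n * 2 ^ n : ℕ) := by
  classical
  set j₀ : ℕ := (L + 1) * F.card + ⌈c * F.card⌉₊ - ℓ * F.card with hj₀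
  -- sparsity of the family
  have hsum : ∑ i ∈ F, (rowVars E i).card ≤ ℓ * F.card :=
    calc ∑ i ∈ F, (rowVars E i).card ≤ ∑ i ∈ F, ℓ := Finset.sum_le_sum fun i _ => by
            rw [rowVars, Finset.card_map]; exact hsparse i
      _ = ℓ * F.card := by rw [Finset.sum_const, smul_eq_mul, mul_comm]
  -- the boundary, pulled back to `Fin n`
  set SB : Finset (Fin n) := univ.filter fun j => (j : ℕ) ∈ boundary (rowVars E) F with hSB
  have hSBcard : SB.card ≤ ℓ * F.card := by
    have h1 : SB.card ≤ (boundary (rowVars E) F).card := by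
      refine Finset.card_le_card_of_injOn (fun j => (j : ℕ)) ?_ ?_
      · intro j hj
        exact Finset.mem_coe.2 (Finset.mem_filter.1 (Finset.mem_coe.1 hj)).2
      · intro j _ j' _ h
        exact Fin.ext h
    have h2 : (boundary (rowVars E) F).card ≤ (cover (rowVars E) F).card :=
      Finset.card_le_card (boundary_subset_cover F)
    have h3 : (cover (rowVars E) F).card ≤ ∑ i ∈ F, (rowVars E i).card := Finset.card_biUnion_le
    omega
  -- every all-overloaded sample assigns at least `j₀` boundary points
  have hthr : ∀ ω ∈ s, j₀ ≤ (SB.filter fun j => ω.1 j = 0).card := by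
    intro ω hω
    have h1 := mul_card_add_card_boundary_le (rowVars E) F
      ((univ.filter fun j : Fin n => ω.1 j = 0).map Fin.valEmbedding) (hs ω hω)
    have h3 : ⌈c * F.card⌉₊ ≤ (boundary (rowVars E) F).card := Nat.ceil_le.2 (hexp F hFr)
    have h4 : ((boundary (rowVars E) F) ∩
        ((univ.filter fun j : Fin n => ω.1 j = 0).map Fin.valEmbedding)).card
        ≤ (SB.filter fun j => ω.1 j = 0).card := by
      rw [← Finset.card_map Fin.valEmbedding]
      refine Finset.card_le_card fun v hv => ?_
      rw [Finset.mem_inter] at hv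
      obtain ⟨hvB, hvA⟩ := hv
      obtain ⟨j, hj, hjv⟩ := Finset.mem_map.1 hvA
      have hjv' : (j : ℕ) = v := by simpa using hjv
      refine Finset.mem_map.2 ⟨j, Finset.mem_filter.2 ⟨Finset.mem_filter.2 ⟨Finset.mem_univ _, ?_⟩,
        (Finset.mem_filter.1 hj).2⟩, hjv⟩
      rw [hjv']
      exact hvB
    omega
  -- count
  rcases Nat.eq_zero_or_pos j₀ with hz | hpos
  · rw [hz, pow_zero, mul_one]
    have h1 : s.card ≤ (K + 1) ^ n * 2 ^ n :=
      (Finset.card_le_univ _).trans (by rw [card_sample])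
    have h1' : (s.card : ℝ) ≤ ((K + 1) ^ n * 2 ^ n : ℕ) := by exact_mod_cast h1
    have h2 : (1 : ℝ) ≤ (2 : ℝ) ^ (ℓ * F.card) := one_le_pow₀ (by norm_num)
    have h3 : (0 : ℝ) ≤ ((K + 1) ^ n * 2 ^ n : ℕ) := Nat.cast_nonneg _
    nlinarith
  · have hL' : j₀ - 1 + 1 = j₀ := Nat.sub_add_cancel hpos
    have h := card_overload_le (K := K) (ℓ := ℓ * F.card) (L := j₀ - 1) SB hSBcard s fun ω hω => by
      rw [hL']; exact hthr ω hω
    rw [hL'] at h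
    exact h

/-- **The master inequality of the ALTERED restriction method (n-free, m-free, no overload
term).** Let the row supports of `E` have size `≤ ℓ`, form an `(r, c)`-boundary expander
(`r ≥ 2`), and let every variable lie in at most `Δ` rows. For every resolution refutation `π` of
`sumEncoding 1 E`, every `L < c`, `W < (c - L) r / 2`, `K`, and `1 ≤ s ≤ r`, with `Q = ⌊W/2⌋ + 1`:
`1 ≤ |π| · (2^{ℓ(s-1)} ((2K+1)/(2K+2))^Q + (QΔ)^s 2^{ℓ s} / (K+1)^{(L+1)s + ⌈c s⌉ - ℓ s})`.
[Beame–Pitassi 1996; Ben-Sasson–Wigderson 2001, §3, Thm. 6.5; Alon–Spencer §3] [folklore] -/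
theorem one_le_length_mul_alter (E : Fin m → LinEqMod 2 n) {r c : ℝ}
    (hexp : IsBoundaryExpander (rowVars E) r c) (hr : 2 ≤ r) {ℓ L W Δ : ℕ} (K s : ℕ)
    (hs : 1 ≤ s) (hsr : (s : ℝ) ≤ r)
    (hsparse : ∀ i, (E i).supp.card ≤ ℓ)
    (hcol : ∀ j : Fin n, ((univ : Finset (Fin m)).filter fun i => j ∈ (E i).supp).card ≤ Δ)
    (hcL : (L : ℝ) < c) (hW : (W : ℝ) < (c - L) * r / 2) {π : List (ResLine ℕ)}
    (hπ : IsResRefutation (sumEncoding 1 E) π) :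
    (1 : ℝ) ≤ π.length *
      ((2 : ℝ) ^ (ℓ * (s - 1)) * ((2 * (K : ℝ) + 1) / (2 * K + 2)) ^ (W / 2 + 1)
        + (((W / 2 + 1) * Δ : ℕ) : ℝ) ^ s * (2 : ℝ) ^ (ℓ * s)
          / ((K : ℝ) + 1) ^ ((L + 1) * s + ⌈c * s⌉₊ - ℓ * s)) := by
  classical
  -- samples, assigned sets, overloaded rows, damaged variables, altered restrictions
  set Aset : (Fin n → Fin (K + 1)) → Finset ℕ := fun u =>
    (univ.filter fun j : Fin n => u j = 0).map Fin.valEmbedding with hAset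
  set Ov : (Fin n → Fin (K + 1)) → Finset (Fin m) := fun u =>
    univ.filter fun i => L + 1 ≤ ((rowVars E i) ∩ Aset u).card with hOv
  set D : (Fin n → Fin (K + 1)) → Finset ℕ := fun u => cover (rowVars E) (Ov u) with hD
  set Dm : (Fin n → Fin (K + 1)) → Finset (Fin n) := fun u =>
    univ.filter fun j => (j : ℕ) ∈ D u with hDm
  set ρ : (Fin n → Fin (K + 1)) × (Fin n → Bool) → ℕ → Option Bool := fun ω v =>
    if h : v < n then (if ω.1 ⟨v, h⟩ = 0 then some (ω.2 ⟨v, h⟩) else none) else some false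
    with hρ
  set ρ' : (Fin n → Fin (K + 1)) × (Fin n → Bool) → ℕ → Option Bool := fun ω v =>
    if v ∈ D ω.1 then none else ρ ω v with hρ'
  -- every sample leaves a bad line (file X applied to the altered restriction)
  have hbad : ∀ ω : (Fin n → Fin (K + 1)) × (Fin n → Bool),
      ∃ l ∈ π, ¬ SatisfiedBy (ρ' ω) l.clause ∧ W < (restrictClause (ρ' ω) l.clause).card := by
    intro ω
    refine exists_unsatisfied_wide_line_alter E hexp hr hcL hW hπ (Aset ω.1) (ρ' ω) ?_
    intro v hv hvA
    have hρ'v : ρ' ω v = if v ∈ D ω.1 then none else ρ ω v := rfl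
    rw [hρ'v]
    split_ifs with hvD
    · rfl
    · have hvA' : v ∉ Aset ω.1 := fun h => hvA (Finset.mem_sdiff.2 ⟨h, hvD⟩)
      have hρv : ρ ω v = if ω.1 ⟨v, hv⟩ = 0 then some (ω.2 ⟨v, hv⟩) else none := by
        simp only [hρ, hv, ↓reduceDIte]
      rw [hρv]
      split_ifs with h0
      · refine absurd ?_ hvA'
        simp only [hAset]
        exact Finset.mem_map.2 ⟨⟨v, hv⟩, Finset.mem_filter.2 ⟨Finset.mem_univ _, h0⟩, rfl⟩
      · rfl
  -- above `n` the altered restriction assigns `false`; on an undamaged assigned `j < n` it is `y j`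
  have hρ'_ge : ∀ ω v, ¬ v < n → ρ' ω v = some false := by
    intro ω v hv
    have hvD : v ∉ D ω.1 := fun h => hv (lt_of_mem_cover h)
    have hρ'v : ρ' ω v = if v ∈ D ω.1 then none else ρ ω v := rfl
    rw [hρ'v, if_neg hvD]
    simp only [hρ, hv, ↓reduceDIte]
  have hρ'_val : ∀ ω (j : Fin n), ω.1 j = 0 → j ∉ Dm ω.1 → ρ' ω j = some (ω.2 j) := by
    intro ω j h0 hjD
    have hjD' : (j : ℕ) ∉ D ω.1 := fun h => hjD (Finset.mem_filter.2 ⟨Finset.mem_univ _, h⟩)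
    have hρ'v : ρ' ω j = if (j : ℕ) ∈ D ω.1 then none else ρ ω j := rfl
    rw [hρ'v, if_neg hjD']
    simp only [hρ, j.2, ↓reduceDIte, Fin.eta, h0, ↓reduceIte]
  -- the bad-line sets cover the sample space
  set B : ResLine ℕ → Finset ((Fin n → Fin (K + 1)) × (Fin n → Bool)) := fun l =>
    univ.filter fun ω => ¬ SatisfiedBy (ρ' ω) l.clause ∧ W < (restrictClause (ρ' ω) l.clause).card
    with hB
  have hcover : (univ : Finset ((Fin n → Fin (K + 1)) × (Fin n → Bool))) ⊆ π.toFinset.biUnion B := by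
    intro ω _
    obtain ⟨l, hl, hlω⟩ := hbad ω
    refine Finset.mem_biUnion.2 ⟨l, List.mem_toFinset.2 hl, ?_⟩
    simp only [hB, Finset.mem_filter, Finset.mem_univ, true_and]
    exact hlω
  -- sizes and the two terms
  set N : ℕ := (K + 1) ^ n * 2 ^ n with hN
  have hcardΩ : Fintype.card ((Fin n → Fin (K + 1)) × (Fin n → Bool)) = N := card_sample n K
  have hNpos : (0 : ℝ) < N := by rw [hN]; positivity
  set Q : ℕ := W / 2 + 1 with hQ
  set j₀ : ℕ := (L + 1) * s + ⌈c * s⌉₊ - ℓ * s with hj₀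
  set t₁ : ℝ := (2 : ℝ) ^ (ℓ * (s - 1)) * ((2 * (K : ℝ) + 1) / (2 * K + 2)) ^ Q with ht₁
  set t₂ : ℝ := ((Q * Δ : ℕ) : ℝ) ^ s * (2 : ℝ) ^ (ℓ * s) / ((K : ℝ) + 1) ^ j₀ with ht₂
  have ht₁0 : 0 ≤ t₁ := by rw [ht₁]; positivity
  have ht₂0 : 0 ≤ t₂ := by rw [ht₂]; positivity
  -- the per-line bound
  have hBcard : ∀ l : ResLine ℕ, ((B l).card : ℝ) ≤ (t₁ + t₂) * N := by
    intro l
    rcases (B l).eq_empty_or_nonempty with h0 | ⟨ω₀, hω₀⟩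
    · rw [h0, Finset.card_empty, Nat.cast_zero]
      exact mul_nonneg (add_nonneg ht₁0 ht₂0) hNpos.le
    set C : Finset (Literal ℕ) := l.clause with hC
    -- the variables of `C` below `n`, and the satisfying values
    set V : Finset (Fin n) := univ.filter fun j => ((j : ℕ), true) ∈ C ∨ ((j : ℕ), false) ∈ C
      with hV
    set b : Fin n → Bool := fun j => decide (((j : ℕ), true) ∈ C) with hb
    have hbC : ∀ j ∈ V, (((j : ℕ), b j) : Literal ℕ) ∈ C := by
      intro j hj
      have hj' := (Finset.mem_filter.1 hj).2
      by_cases ht : ((j : ℕ), true) ∈ C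
      · simp [hb, ht]
      · simpa [hb, ht] using hj'.resolve_left ht
    -- a bad sample keeps `> W` literals, all below `n`: `Q ≤ |V|`
    have hQV : Q ≤ V.card := by
      have hω₀' := (Finset.mem_filter.1 hω₀).2
      obtain ⟨-, hwide⟩ := hω₀'
      have hsub : restrictClause (ρ' ω₀) C
          ⊆ (V ×ˢ (univ : Finset Bool)).image fun p => (((p.1 : ℕ), p.2) : Literal ℕ) := by
        intro lit hl
        obtain ⟨hlC, hnone⟩ := mem_restrictClause.1 hl
        have hln : lit.1 < n := by
          by_contra h
          rw [hρ'_ge ω₀ lit.1 h] at hnone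
          exact absurd hnone (Option.some_ne_none false)
        refine Finset.mem_image.2 ⟨(⟨lit.1, hln⟩, lit.2), Finset.mem_product.2 ⟨?_, Finset.mem_univ _⟩, ?_⟩
        · refine Finset.mem_filter.2 ⟨Finset.mem_univ _, ?_⟩
          rcases hb2 : lit.2 with _ | _
          · right; have : lit = (lit.1, false) := by ext <;> simp [hb2]
            rw [this] at hlC; exact hlC
          · left; have : lit = (lit.1, true) := by ext <;> simp [hb2]
            rw [this] at hlC; exact hlC
        · ext <;> simp
      have hle : (restrictClause (ρ' ω₀) C).card ≤ 2 * V.card :=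
        calc (restrictClause (ρ' ω₀) C).card
            ≤ ((V ×ˢ (univ : Finset Bool)).image fun p => (((p.1 : ℕ), p.2) : Literal ℕ)).card :=
              Finset.card_le_card hsub
          _ ≤ (V ×ˢ (univ : Finset Bool)).card := Finset.card_image_le
          _ = 2 * V.card := by rw [Finset.card_product, Finset.card_univ, Fintype.card_bool, mul_comm]
      have hwide' : W < 2 * V.card := lt_of_lt_of_le hwide hle
      omega
    obtain ⟨T₀, hT₀V, hT₀card⟩ := Finset.exists_subset_card_eq hQV
    -- split the bad samples by the number of damaged assigned points of `T₀`
    set S₁ : Finset ((Fin n → Fin (K + 1)) × (Fin n → Bool)) :=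
      (B l).filter fun ω => (T₀.filter fun j => ω.1 j = 0 ∧ j ∈ Dm ω.1).card ≤ ℓ * (s - 1) with hS₁
    set S₂ : Finset ((Fin n → Fin (K + 1)) × (Fin n → Bool)) :=
      (B l).filter fun ω => ¬ (T₀.filter fun j => ω.1 j = 0 ∧ j ∈ Dm ω.1).card ≤ ℓ * (s - 1)
      with hS₂
    have hsplit : (B l).card = S₁.card + S₂.card :=
      (Finset.card_filter_add_card_filter_not _).symm
    -- (1) few damaged points: the fibrewise count of file IX
    have hS₁ : (S₁.card : ℝ) ≤ t₁ * N := by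
      have h := card_fiber_damage_le (K := K) (t₀ := ℓ * (s - 1)) T₀ b Dm S₁ fun ω hω => by
        obtain ⟨hωB, hωY⟩ := Finset.mem_filter.1 hω
        obtain ⟨hns, -⟩ := (Finset.mem_filter.1 hωB).2
        refine ⟨fun j hj h0 hjD hyb => hns ⟨((j : ℕ), b j), hbC j (hT₀V hj), ?_⟩, hωY⟩
        rw [hρ'_val ω j h0 hjD, hyb]
      rw [hT₀card] at h
      rw [ht₁]
      exact h
    -- (2) many damaged points: `s` distinct overloaded rows meet `T₀`
    have hS₂ : (S₂.card : ℝ) ≤ t₂ * N := by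
      set R : Finset (Fin m) := univ.filter fun i => ∃ j ∈ T₀, j ∈ (E i).supp with hR
      set Bad : Finset (Fin m) → Finset ((Fin n → Fin (K + 1)) × (Fin n → Bool)) := fun F =>
        univ.filter fun ω => ∀ i ∈ F, L + 1 ≤ ((rowVars E i) ∩ Aset ω.1).card with hBad
      have hsub : S₂ ⊆ (R.powersetCard s).biUnion Bad := by
        intro ω hω
        obtain ⟨hωB, hωY⟩ := Finset.mem_filter.1 hω
        set Dam : Finset (Fin n) := T₀.filter fun j => ω.1 j = 0 ∧ j ∈ Dm ω.1 with hDam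
        have hDamcard : ℓ * s + 1 ≤ Dam.card + ℓ := by
          have h1 : ℓ * (s - 1) + 1 ≤ Dam.card := by
            have : ¬ Dam.card ≤ ℓ * (s - 1) := hωY
            omega
          have h2 : ℓ * s = ℓ * (s - 1) + ℓ := by
            calc ℓ * s = ℓ * (s - 1 + 1) := by rw [Nat.sub_add_cancel hs]
              _ = ℓ * (s - 1) + ℓ := by ring
          omega
        have hcovD : ∀ j ∈ Dam, ∃ i ∈ Ov ω.1, j ∈ (E i).supp := by
          intro j hj
          have hjDm : j ∈ Dm ω.1 := (Finset.mem_filter.1 hj).2.2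
          have hjD : (j : ℕ) ∈ D ω.1 := (Finset.mem_filter.1 hjDm).2
          obtain ⟨i, hi, hji⟩ := mem_cover.1 hjD
          obtain ⟨j', hj', hjj'⟩ := mem_rowVars.1 hji
          have hjeq : j' = j := Fin.ext hjj'
          exact ⟨i, hi, hjeq ▸ hj'⟩
        obtain ⟨F, hFO, hFcard, hFmeet⟩ :=
          exists_overloaded_family (fun i => (E i).supp) hsparse (Ov ω.1) s hs Dam hDamcard hcovD
        refine Finset.mem_biUnion.2 ⟨F, Finset.mem_powersetCard.2 ⟨?_, hFcard⟩, ?_⟩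
        · intro i hi
          obtain ⟨j, hj, hji⟩ := hFmeet i hi
          exact Finset.mem_filter.2 ⟨Finset.mem_univ _, j, (Finset.mem_filter.1 hj).1, hji⟩
        · simp only [hBad, Finset.mem_filter, Finset.mem_univ, true_and]
          intro i hi
          exact (Finset.mem_filter.1 (hFO hi)).2
      have hRcard : R.card ≤ Q * Δ := by
        have h1 : R ⊆ T₀.biUnion fun j => univ.filter fun i : Fin m => j ∈ (E i).supp := by
          intro i hi
          obtain ⟨j, hj, hji⟩ := (Finset.mem_filter.1 hi).2
          exact Finset.mem_biUnion.2 ⟨j, hj, Finset.mem_filter.2 ⟨Finset.mem_univ _, hji⟩⟩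
        calc R.card ≤ (T₀.biUnion fun j => univ.filter fun i : Fin m => j ∈ (E i).supp).card :=
              Finset.card_le_card h1
          _ ≤ ∑ j ∈ T₀, (univ.filter fun i : Fin m => j ∈ (E i).supp).card := Finset.card_biUnion_le
          _ ≤ ∑ j ∈ T₀, Δ := Finset.sum_le_sum fun j _ => hcol j
          _ = Q * Δ := by rw [Finset.sum_const, smul_eq_mul, hT₀card]
      have hKpos : (0 : ℝ) < ((K : ℝ) + 1) ^ j₀ := by positivity
      have hBadcard : ∀ F ∈ R.powersetCard s,
          ((Bad F).card : ℝ) ≤ (2 : ℝ) ^ (ℓ * s) / ((K : ℝ) + 1) ^ j₀ * N := by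
        intro F hF
        have hFcard : F.card = s := (Finset.mem_powersetCard.1 hF).2
        have hFr : (F.card : ℝ) ≤ r := by rw [hFcard]; exact hsr
        have h := card_all_overloaded_le E hexp (K := K) (L := L) hsparse F hFr (Bad F)
          fun ω hω => (Finset.mem_filter.1 hω).2
        rw [hFcard] at h
        rw [div_mul_eq_mul_div, le_div_iff₀ hKpos]
        exact h
      calc (S₂.card : ℝ) ≤ (((R.powersetCard s).biUnion Bad).card : ℝ) := by
            exact_mod_cast Finset.card_le_card hsub
        _ ≤ ∑ F ∈ R.powersetCard s, ((Bad F).card : ℝ) := by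
            exact_mod_cast Finset.card_biUnion_le
        _ ≤ ∑ F ∈ R.powersetCard s, (2 : ℝ) ^ (ℓ * s) / ((K : ℝ) + 1) ^ j₀ * N :=
            Finset.sum_le_sum hBadcard
        _ = ((R.card.choose s : ℕ) : ℝ) * ((2 : ℝ) ^ (ℓ * s) / ((K : ℝ) + 1) ^ j₀ * N) := by
            rw [Finset.sum_const, Finset.card_powersetCard, nsmul_eq_mul]
        _ ≤ (((Q * Δ) ^ s : ℕ) : ℝ) * ((2 : ℝ) ^ (ℓ * s) / ((K : ℝ) + 1) ^ j₀ * N) := by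
            refine mul_le_mul_of_nonneg_right ?_ (by positivity)
            exact_mod_cast (Nat.choose_le_pow _ _).trans (Nat.pow_le_pow_left hRcard s)
        _ = t₂ * N := by rw [ht₂]; push_cast; ring
    calc ((B l).card : ℝ) = S₁.card + S₂.card := by rw [hsplit]; push_cast; ring
      _ ≤ t₁ * N + t₂ * N := add_le_add hS₁ hS₂
      _ = (t₁ + t₂) * N := by ring
  -- total count
  have h1 : N ≤ ∑ l ∈ π.toFinset, (B l).card :=
    calc N = (univ : Finset ((Fin n → Fin (K + 1)) × (Fin n → Bool))).card := by
          rw [Finset.card_univ, hcardΩ]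
      _ ≤ (π.toFinset.biUnion B).card := Finset.card_le_card hcover
      _ ≤ ∑ l ∈ π.toFinset, (B l).card := Finset.card_biUnion_le
  have h1' : (N : ℝ) ≤ ∑ l ∈ π.toFinset, ((B l).card : ℝ) := by exact_mod_cast h1
  have h2 : (N : ℝ) ≤ π.toFinset.card * ((t₁ + t₂) * N) :=
    calc (N : ℝ) ≤ ∑ l ∈ π.toFinset, ((B l).card : ℝ) := h1'
      _ ≤ ∑ l ∈ π.toFinset, (t₁ + t₂) * N := Finset.sum_le_sum fun l _ => hBcard l
      _ = π.toFinset.card * ((t₁ + t₂) * N) := by rw [Finset.sum_const, nsmul_eq_mul]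
  have hπ' : (π.toFinset.card : ℝ) ≤ π.length := by exact_mod_cast List.toFinset_card_le π
  have h3 : (N : ℝ) ≤ π.length * (t₁ + t₂) * N :=
    calc (N : ℝ) ≤ π.toFinset.card * ((t₁ + t₂) * N) := h2
      _ ≤ π.length * ((t₁ + t₂) * N) :=
          mul_le_mul_of_nonneg_right hπ' (mul_nonneg (add_nonneg ht₁0 ht₂0) hNpos.le)
      _ = π.length * (t₁ + t₂) * N := by ring
  by_contra hlt
  push Not at hlt
  have : π.length * (t₁ + t₂) * N < 1 * N := mul_lt_mul_of_pos_right hlt hNpos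
  linarith

end Summit.PneNP.PneNP.Theorems.ResNFree
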